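import Literature.AlgebraicGeometry.Resolution.AbhyankarToroidalChartsProofs
import Literature.AlgebraicGeometry.Resolution.LocalBlowup
import Mathlib.RingTheory.Localization.AtPrime.Basic
import Mathlib.RingTheory.LocalRing.ResidueField.Basic
import Mathlib.RingTheory.Smooth.Locus
import Mathlib.RingTheory.Smooth.Field
import Mathlib.RingTheory.Etale.Field
import Mathlib.RingTheory.RegularLocalRing.Defs
import HarnessLib

/-!
# The local ring of the centre of a valuation on an affine model, inside the function field

Topic: `Literature/AlgebraicGeometry/Resolution`. Folklore API for the explicit local ring
`A = N_𝔭 ⊆ L` (`centreLocalRing O N`, `AbhyankarToroidalCharts.lean`: the fractions `a / b`,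
`a, b ∈ N`, `|b| = 1`) of the centre `𝔭 = 𝔪_{L°} ∩ N` (`centreIdeal`, `LocalUniformization.lean`)
of a valuation ring `O = L°` on an affine model `Spec N`, `N ⊆ L°` a `k`-subalgebra of the valued
field `L` over the trivially valued `k ⊆ L°`. It is used by the assembly of Temkin's
uniformization of Abhyankar valuations (M. Temkin, *Inseparable local uniformization*,
J. Algebra 373 (2013) 65–119, proof of Thm. 5.5.2, pp. 60–61 of arXiv:0804.1554v3), where the
local rings of the centres on several models are COMPARED INSIDE `L` ("the local rings `A_M` and
`A'_M` in `K` coincide", Prop. 5.4.3) and smoothness, regularity and residual separability have to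
be moved between Mathlib's abstract `Localization.AtPrime 𝔭` and these subrings:

* `isLocalization_centreLocalRing` — `centreLocalRing O N` is the localization of `N` at `𝔭`
  (Mathlib `IsLocalization.AtPrime`), hence `Localization.AtPrime 𝔭 ≃ₐ[k] centreLocalRing O N`
  (`nonempty_algEquiv_centreLocalRing`); consequently `Algebra.IsSmoothAt k 𝔭` and regularity of
  `N_𝔭` only depend on the subring `centreLocalRing O N ⊆ L` (`isSmoothAt_centreIdeal_iff`,
  `isRegularLocalRing_centre_iff`).
* `centreLocalRing_eq_of_le_of_le` — sandwich: `P ≤ N ≤ P_𝔭 ⇒ N_𝔭 = P_𝔭` in `L` (with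
  `mem_centreLocalRing_of_isIntegral` of `AbhyankarToroidalChartsProofs.lean` — `P_𝔭` is
  integrally closed in `L` when `P` is — this identifies the local rings of sandwiched models).
* `formallySmooth_residueField_centre` — **simple points**: if the local ring `N_𝔭 ⊆ L°` contains
  elements `y₁, …, y_F` whose residues form a transcendence basis `ȳ` of the residue field `L̃`
  over `k` with `L̃` separable (algebraic) over `k(ȳ)`, then the residue field `k(𝔭)` of `N_𝔭`
  is formally smooth over `k` (it embeds into `L̃` over `k(ȳ)`, so it is a separable algebraic
  extension of the purely transcendental `k(ȳ)`). This is how "`k(x₁) ⊂ K̃₁` is separable over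
  `k`, [so] `x₁` is even a simple `k`-smooth point" (proof of Thm. 5.5.2, p. 61) is rendered.

## Source

* M. Temkin, *Inseparable local uniformization*, J. Algebra 373 (2013) 65–119 =
  arXiv:0804.1554v3, §5.4 (p. 56: the local rings `A_{B,M}`) and proof of Thm. 5.5.2 (pp. 60–61).
  Everything in this file is standard commutative algebra ([folklore]).
-/

noncomputable section

namespace Literature.AlgebraicGeometry.Resolution

open IsLocalRing ValuationSubring

universe u

variable {k L : Type u} [Field k] [Field L] [Algebra k L] {O : ValuationSubring L}

/-! ### The centre and its complement -/

section Centre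

variable (N : Subalgebra k L) (hN : N.toSubring ≤ O.toSubring)

/-- Membership in the centre `𝔪_{L°} ∩ N` is `|n| < 1`. [folklore] -/
theorem mem_centreIdeal_iff (n : N) : n ∈ centreIdeal N O hN ↔ O.valuation (n : L) < 1 := by
  change n ∈ Ideal.comap _ (IsLocalRing.maximalIdeal O) ↔ _
  rw [Ideal.mem_comap]
  exact ValuationSubring.valuation_lt_one_iff O _

/-- Outside the centre the value is `1` (elements of `N ⊆ L°` have value `≤ 1`). [folklore] -/
theorem not_mem_centreIdeal_iff (n : N) : n ∉ centreIdeal N O hN ↔ O.valuation (n : L) = 1 := by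
  rw [mem_centreIdeal_iff, not_lt]
  have hle : O.valuation (n : L) ≤ 1 := (O.valuation_le_one_iff _).mpr (hN n.2)
  exact ⟨fun h => le_antisymm hle h, fun h => h.ge⟩

end Centre

/-! ### `centreLocalRing O N` is the localization of `N` at the centre -/

section Localization

variable (N : Subalgebra k L) (hN : N.toSubring ≤ O.toSubring)

/-- **`N_𝔭 = centreLocalRing O N`**: with the `N`-algebra structure given by the inclusion
`N ⊆ centreLocalRing O N`, the subalgebra of fractions `a / b` (`|b| = 1`) is the localization of
`N` at the centre `𝔭 = 𝔪_{L°} ∩ N`. [folklore] -/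
theorem isLocalization_centreLocalRing :
    letI := (Subalgebra.inclusion (le_centreLocalRing (O := O) N)).toRingHom.toAlgebra
    IsLocalization.AtPrime (centreLocalRing O N) (centreIdeal N O hN) := by
  letI := (Subalgebra.inclusion (le_centreLocalRing (O := O) N)).toRingHom.toAlgebra
  refine ⟨?_, ?_, ?_⟩
  · rintro ⟨s, hs⟩
    have hs1 : O.valuation (s : L) = 1 := (not_mem_centreIdeal_iff N hN s).mp hs
    have hs0 : (s : L) ≠ 0 := ne_zero_of_valuation_eq_one hs1
    refine isUnit_iff_exists_inv.mpr ⟨⟨(s : L)⁻¹, ?_⟩, ?_⟩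
    · have h := inv_mem_centreLocalRing (O := O) (N := N) s.2 N.one_mem hs1
      rwa [div_one] at h
    · apply Subtype.ext
      change (s : L) * (s : L)⁻¹ = 1
      exact mul_inv_cancel₀ hs0
  · rintro ⟨w, hw⟩
    obtain ⟨a, ha, b, hb, hb1, rfl⟩ := hw
    refine ⟨⟨⟨a, ha⟩, ⟨⟨b, hb⟩, (not_mem_centreIdeal_iff N hN ⟨b, hb⟩).mpr hb1⟩⟩, ?_⟩
    apply Subtype.ext
    change a / b * b = a
    exact div_mul_cancel₀ a (ne_zero_of_valuation_eq_one hb1)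
  · intro a b h
    refine ⟨1, ?_⟩
    have : (a : L) = b := congrArg (fun t : centreLocalRing O N => (t : L)) h
    rw [Subtype.ext this]

/-- **`Localization.AtPrime 𝔭 ≃ₐ[k] centreLocalRing O N`** for the centre `𝔭` of `L°` on `N`.
[folklore] -/
theorem nonempty_algEquiv_centreLocalRing :
    Nonempty (Localization.AtPrime (centreIdeal N O hN) ≃ₐ[k] centreLocalRing O N) := by
  letI := (Subalgebra.inclusion (le_centreLocalRing (O := O) N)).toRingHom.toAlgebra
  haveI : IsScalarTower k N (centreLocalRing O N) := IsScalarTower.of_algebraMap_eq fun _ => rfl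
  haveI := isLocalization_centreLocalRing N hN
  exact ⟨(Localization.algEquiv (centreIdeal N O hN).primeCompl (centreLocalRing O N)).restrictScalars k⟩

/-- Smoothness at the centre is formal smoothness of the subring `centreLocalRing O N ⊆ L` over
`k`. [folklore] -/
theorem isSmoothAt_centreIdeal_iff :
    Algebra.IsSmoothAt k (centreIdeal N O hN) ↔ Algebra.FormallySmooth k (centreLocalRing O N) := by
  obtain ⟨e⟩ := nonempty_algEquiv_centreLocalRing N hN
  exact ⟨fun _ => Algebra.FormallySmooth.of_equiv e, fun _ => Algebra.FormallySmooth.of_equiv e.symm⟩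

/-- Regularity at the centre is regularity of the subring `centreLocalRing O N ⊆ L`. [folklore] -/
theorem isRegularLocalRing_centre_iff :
    IsRegularLocalRing (Localization.AtPrime (centreIdeal N O hN)) ↔
      IsRegularLocalRing (centreLocalRing O N) := by
  obtain ⟨e⟩ := nonempty_algEquiv_centreLocalRing N hN
  exact ⟨fun _ => IsRegularLocalRing.of_ringEquiv e.toRingEquiv,
    fun _ => IsRegularLocalRing.of_ringEquiv e.symm.toRingEquiv⟩

/-- The residue field at the centre only depends on the subring `centreLocalRing O N ⊆ L`: an
equality of these subrings for two models transports formal smoothness of the residue field.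
[folklore] -/
theorem formallySmooth_residueField_centre_of_eq {N' : Subalgebra k L}
    (hN' : N'.toSubring ≤ O.toSubring) (h : centreLocalRing O N = centreLocalRing O N')
    (hs : Algebra.FormallySmooth k
      (ResidueField (Localization.AtPrime (centreIdeal N O hN)))) :
    Algebra.FormallySmooth k (ResidueField (Localization.AtPrime (centreIdeal N' O hN'))) := by
  obtain ⟨e⟩ := nonempty_algEquiv_centreLocalRing N hN
  obtain ⟨e'⟩ := nonempty_algEquiv_centreLocalRing N' hN'
  let f : Localization.AtPrime (centreIdeal N O hN) ≃ₐ[k]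
      Localization.AtPrime (centreIdeal N' O hN') :=
    (e.trans (Subalgebra.equivOfEq _ _ h)).trans e'.symm
  exact Algebra.FormallySmooth.of_equiv (IsLocalRing.ResidueField.mapAlgEquiv f)

/-- … and so do smoothness and regularity at the centre. [folklore] -/
theorem isSmoothAt_centre_of_eq {N' : Subalgebra k L} (hN' : N'.toSubring ≤ O.toSubring)
    (h : centreLocalRing O N = centreLocalRing O N')
    (hs : Algebra.IsSmoothAt k (centreIdeal N O hN)) :
    Algebra.IsSmoothAt k (centreIdeal N' O hN') := by
  rw [isSmoothAt_centreIdeal_iff] at hs ⊢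
  exact Algebra.FormallySmooth.of_equiv (Subalgebra.equivOfEq _ _ h)

/-- See `isSmoothAt_centre_of_eq`. [folklore] -/
theorem isRegularLocalRing_centre_of_eq {N' : Subalgebra k L} (hN' : N'.toSubring ≤ O.toSubring)
    (h : centreLocalRing O N = centreLocalRing O N')
    (hr : IsRegularLocalRing (Localization.AtPrime (centreIdeal N O hN))) :
    IsRegularLocalRing (Localization.AtPrime (centreIdeal N' O hN')) := by
  rw [isRegularLocalRing_centre_iff] at hr ⊢
  exact IsRegularLocalRing.of_ringEquiv (Subalgebra.equivOfEq _ _ h).toRingEquiv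

end Localization

/-! ### Sandwiches and integral closedness of the local ring -/

section Sandwich

/-- **Sandwich**: if `P ≤ N ≤ P_𝔭` inside `L` then `N_𝔭 = P_𝔭` (the local rings of the centres of
`L°` on `Spec N` and `Spec P` coincide). [folklore] -/
theorem centreLocalRing_eq_of_le_of_le {P N : Subalgebra k L} (hPN : P ≤ N)
    (hNP : N ≤ centreLocalRing O P) : centreLocalRing O N = centreLocalRing O P := by
  refine le_antisymm ?_ (centreLocalRing_mono hPN)
  rintro _ ⟨a, ha, b, hb, hb1, rfl⟩
  obtain ⟨a₁, ha₁, a₂, ha₂, ha₂1, rfl⟩ := hNP ha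
  obtain ⟨b₁, hb₁, b₂, hb₂, hb₂1, rfl⟩ := hNP hb
  have hb₁1 : O.valuation b₁ = 1 := by
    rw [map_div₀, hb₂1, div_one] at hb1
    exact hb1
  refine ⟨a₁ * b₂, P.mul_mem ha₁ hb₂, a₂ * b₁, P.mul_mem ha₂ hb₁,
    by rw [map_mul, ha₂1, hb₁1, mul_one], ?_⟩
  have ha₂0 := ne_zero_of_valuation_eq_one ha₂1
  have hb₂0 := ne_zero_of_valuation_eq_one hb₂1
  have hb₁0 := ne_zero_of_valuation_eq_one hb₁1
  field_simp

end Sandwich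

/-! ### Simple points: separability of the residue field at the centre -/

section Residue

variable (hk : ∀ c : k, algebraMap k L c ∈ O) (N : Subalgebra k L) (hN : N.toSubring ≤ O.toSubring)

/-- An intermediate field of a separable algebraic extension `E/F₀` with `F₀` formally smooth over
`k` is formally smooth over `k`. [folklore] -/
theorem formallySmooth_of_le_of_isSeparable {E : Type*} [Field E] [Algebra k E]
    (F₀ M : IntermediateField k E) (hle : F₀ ≤ M) [Algebra.IsSeparable F₀ E]
    [Algebra.FormallySmooth k F₀] : Algebra.FormallySmooth k M := by
  let M' : IntermediateField F₀ E := IntermediateField.extendScalars hle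
  haveI : Algebra.IsSeparable F₀ M' := Algebra.isSeparable_tower_bot_of_isSeparable F₀ M' E
  haveI : Algebra.FormallyEtale F₀ M' := Algebra.FormallyEtale.of_isSeparable F₀ M'
  haveI : Algebra.FormallySmooth k M' := Algebra.FormallySmooth.comp k F₀ M'
  let f : M' →ₐ[k] M :=
    { toFun := fun x => ⟨x.1, x.2⟩
      map_one' := rfl
      map_mul' := fun _ _ => rfl
      map_zero' := rfl
      map_add' := fun _ _ => rfl
      commutes' := fun _ => rfl }
  exact Algebra.FormallySmooth.of_equiv (AlgEquiv.ofBijective f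
    ⟨fun a b h => Subtype.ext (congrArg Subtype.val h), fun y => ⟨⟨y.1, y.2⟩, rfl⟩⟩)


/-- **Simple points** (Temkin 2013, proof of Thm. 5.5.2, p. 61: "since `k(x₁) ⊂ K̃₁` is separable
over `k`, `x₁` is even a simple `k`-smooth point"). Let `N ⊆ L°` be a `k`-subalgebra with centre
`𝔭`, and suppose the local ring `N_𝔭 ⊆ L` contains elements `y₁, …, y_F ∈ L°` whose residues
`ȳ` form a transcendence basis of the residue field `L̃` over `k` such that `L̃` is separable over
`k(ȳ)`. Then the residue field `k(𝔭)` is formally smooth over `k`: the local homomorphism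
`N_𝔭 → L°` embeds `k(𝔭)` into `L̃` over `k(ȳ)`, so `k(𝔭)` is a separable algebraic extension of
the purely transcendental (formally smooth) `k(ȳ)`. [folklore] -/
theorem formallySmooth_residueField_centre {F : ℕ} (y : Fin F → O)
    (hymem : ∀ i, (y i : L) ∈ centreLocalRing O N)
    (hy : letI := algebraOfMem k O hk
      IsTranscendenceBasis k fun i => residue O (y i))
    (hsep : letI := algebraOfMem k O hk
      ∀ z : ResidueField O, IsSeparable
        (IntermediateField.adjoin k (Set.range fun i => residue O (y i))) z) :
    Algebra.FormallySmooth k (ResidueField (Localization.AtPrime (centreIdeal N O hN))) := by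
  letI := algebraOfMem k O hk
  haveI := isScalarTower_algebraOfMem k O hk
  set 𝔭 := centreIdeal N O hN with h𝔭
  -- the local homomorphism `N_𝔭 → L°`
  let g : N →ₐ[k] O :=
    { toRingHom := (Subring.inclusion hN : N →+* O), commutes' := fun _ => rfl }
  have hgval : ∀ n : N, ((g n : O) : L) = n := fun _ => rfl
  have hg : ∀ s : 𝔭.primeCompl, IsUnit (g s) := fun s => by
    rw [ValuationSubring.valuation_eq_one_iff, hgval]
    exact (not_mem_centreIdeal_iff N hN s).mp s.2
  let f : Localization.AtPrime 𝔭 →ₐ[k] O :=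
    IsLocalization.liftAlgHom (M := 𝔭.primeCompl) (f := g) hg
  have hf : ∀ (a : N) (s : 𝔭.primeCompl) (v : O), f (IsLocalization.mk' _ a s) = v ↔ g a = g s * v :=
    fun a s v => IsLocalization.lift_mk'_spec (hg := hg) a v s
  haveI : IsLocalHom f := by
    constructor
    intro x hx
    obtain ⟨⟨a, s⟩, rfl⟩ := IsLocalization.mk'_surjective 𝔭.primeCompl x
    rw [IsLocalization.AtPrime.isUnit_mk'_iff (Localization.AtPrime 𝔭) 𝔭 a s]
    have hrel : g a = g s * f (IsLocalization.mk' _ a s) := (hf a s _).mp rfl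
    have hga : IsUnit (g a) := by
      rw [hrel]
      exact (hg s).mul hx
    rw [ValuationSubring.valuation_eq_one_iff, hgval] at hga
    exact (not_mem_centreIdeal_iff N hN a).mpr hga
  -- the induced embedding of residue fields, over `k`
  let ψ : ResidueField (Localization.AtPrime 𝔭) →ₐ[k] ResidueField O :=
    IsLocalRing.ResidueField.mapAlgHom f
  set F₀ : IntermediateField k (ResidueField O) :=
    IntermediateField.adjoin k (Set.range fun i => residue O (y i)) with hF₀
  -- its range contains `k(ȳ)`
  have hF₀ψ : F₀ ≤ ψ.fieldRange := by
    rw [hF₀, IntermediateField.adjoin_le_iff]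
    rintro _ ⟨i, rfl⟩
    obtain ⟨a, ha, b, hb, hb1, hab⟩ := hymem i
    have hbc : (⟨b, hb⟩ : N) ∈ 𝔭.primeCompl := (not_mem_centreIdeal_iff N hN ⟨b, hb⟩).mpr hb1
    refine ⟨residue _ (IsLocalization.mk' (Localization.AtPrime 𝔭) (⟨a, ha⟩ : N)
      ⟨⟨b, hb⟩, hbc⟩), ?_⟩
    change IsLocalRing.ResidueField.mapAlgHom f (residue _ _) = residue O (y i)
    rw [IsLocalRing.ResidueField.mapAlgHom_residue]
    congr 1
    refine (hf ⟨a, ha⟩ ⟨⟨b, hb⟩, hbc⟩ (y i)).mpr (Subtype.ext ?_)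
    change a = b * (y i : L)
    rw [hab, mul_div_cancel₀ a (ne_zero_of_valuation_eq_one hb1)]
  -- separability and formal smoothness
  haveI : Algebra.IsSeparable F₀ (ResidueField O) := ⟨hsep⟩
  haveI : Algebra.FormallySmooth k F₀ := Algebra.FormallySmooth.adjoin_of_algebraicIndependent hy.1
  haveI : Algebra.FormallySmooth k ψ.fieldRange :=
    formallySmooth_of_le_of_isSeparable F₀ ψ.fieldRange hF₀ψ
  exact Algebra.FormallySmooth.of_equiv
    (show ResidueField (Localization.AtPrime 𝔭) ≃ₐ[k] ψ.fieldRange from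
      AlgEquiv.ofInjectiveField ψ).symm

end Residue

end Literature.AlgebraicGeometry.Resolution

end
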